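import Literature.NumberTheory.GaloisCohomology.Howard2004.FiniteSingularEvaluation
import HarnessLib

/-!
# Route `GenusKolyvaginAtTwo`, crux U_T `ShaCardDvdPowAtTwoRT` (stmt-BirchSwinnertonDyer-23658; upper half
# `#Ш(E/K)[2^∞] ∣ 2^(2M₀)`) — THE SINGULAR SIDE WITH A NON-TRIVIAL FROBENIUS: `H¹(F, W)/H¹_ur(F, W) ≅ {a ∈ W : φ·a = q·a}` by evaluation at
# a tame generator, for a finite unramified `W` of order prime to the residue characteristic

Seat `bsd-line-gk2-p3` g25 (PROVER seat 3/3, cell `bsd-f1-sign2`), `--supports stmt-BirchSwinnertonDyer-23658` (helper; closes nothing).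
THEOREMS ONLY (no definition, no named fact, no `sorry`).  BSD is NOT proved by any of this; neither is U_T nor any stub.

WHY (seat memo `Cruxes/ShaCardDvdPowAtTwoRT/Lines/norm-sharp-upper-gk2p3.md` §4/§10, stub «ℚ_ℓ cyclic local duality» of the twin-descent line;
companion of `…RTUnramifiedParametrizationFrob` (p744060), which does the unramified side `H¹_ur(F, W) ≅ W/(φ − 1)W`).  Howard's Prop. 1.1.7
in the tree (`Howard2004.singularEval_bijective`: `H¹_s(F, N) ≅ N` by evaluation at a tame generator) assumes the WHOLE `Γ_F` acts trivially on
`N` and `(q − 1)·N = 0` — both FALSE for `E[2^M]` over `ℚ_ℓ` at a Kolyvagin prime for `2` (`Frob_ℓ` acts as complex conjugation, and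
`v₂(ℓ − 1) = 1`).  This file proves the general form: for `W` finite discrete of order prime to the residue characteristic on which only INERTIA
acts trivially, and `φ` an arithmetic Frobenius, there are a tame generator `σ₀ ∈ I_F` (at level `#W`) and an additive
`sing : H¹(F, W) → W`, `[z] ↦ z(σ₀)`, with **kernel EXACTLY `H¹_ur(F, W)`**, satisfying the **twist relation `φ·sing(c) = q·sing(c)` for EVERY
class** (cocycle identity `z(φσ₀φ⁻¹) = φ·z(σ₀)` against the tame relation `f(φσφ⁻¹) = q·f(σ)`), and with **image EXACTLY `{a : φ·a = q·a}`**
(`H¹(F, W) ↠ H¹(I_F, W)^{Fr}`).  So `H¹_s(F, W) := H¹/H¹_ur ≅ W^{φ = q}` — «`H¹_s ≅ Hom(I, W)^{Fr} = W(−1)^{Fr}`» (Rubin Lemma 1.3.2 (ii),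
Mazur–Rubin Lemma 1.2.1) with the Frobenius kept.  For `W = E[2^M]` over `ℚ_ℓ`, `ℓ` Kolyvagin for `2` at level `M` (`2^M ∣ ℓ + 1`, `φ = τ` on the
regular frame): `W^{φ = ℓ} = W^{τ = −1} = ℤ·(P₀ − τP₀)` is CYCLIC of order `2^M` (LEAD's `…RTEigenNorms`) — the second half of the cyclic local
frame over `ℚ_ℓ`: McCallum's Lemma 5.3 loses no bit over `ℚ`.
* `apply_frob_conj_eq_rho_apply` — the cocycle identity `z(φσφ⁻¹) = φ·z(σ)` for `σ ∈ I_F` acting trivially;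
* **`exists_singular_parametrization_of_inertia_trivial`** — `σ₀`, `sing`, kernel, twist relation, image.

References: [SerreInventiones1972] §1.3 Prop. 2, §1.7 Prop. 5, §1.8 Prop. 6; [Rubin2000] Lemma 1.3.2; [MazurRubinMemoirs2004] Lemma 1.2.1;
[Howard2004HeegnerKolyvagin] Prop. 1.1.7; [McCallumLMS1991] §4 Prop. 4.4, §5 Lemma 5.3.
-/

set_option autoImplicit false

noncomputable section

open Function Field ValuativeRel
open scoped Classical
open Literature.NumberTheory.GaloisRepresentations
open Literature.NumberTheory.GaloisRepresentations.DiscreteGaloisModule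
open Literature.NumberTheory.GaloisRepresentations.IsNonarchimedeanLocalField
open Literature.NumberTheory.GaloisCohomology.Howard2004
open Literature.NumberTheory.EllipticCurves (subgroupConj subgroupConj_apply_coe conj_mem_of_normal)

-- the Theorems namespace of this sub repeats the summit name by design (D-0017 nested layout)
set_option linter.dupNamespace false

namespace Summit.BirchSwinnertonDyer.BirchSwinnertonDyer.Theorems.GenusExact.PlusDescent

section Generic

variable {F : Type} [Field F] [ValuativeRel F] [TopologicalSpace F] [IsNonarchimedeanLocalField F]
variable {W : Type} [AddCommGroup W] [TopologicalSpace W] [DiscreteTopology W]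
  (ρ : DiscreteGaloisModule F W)

omit [ValuativeRel F] [TopologicalSpace F] [IsNonarchimedeanLocalField F] in
/-- **The cocycle identity at a Frobenius conjugate**: if `σ` and `φσφ⁻¹` act trivially on `W`, then every continuous cocycle `z` of `Γ_F` satisfies
`z(φσφ⁻¹) = φ·z(σ)` (from `z(φ) + φ·z(φ⁻¹) = 0`). [cite: SerreGaloisCohomology1997, I §5.1] -/
theorem apply_frob_conj_eq_rho_apply (z : contOneCocycles ρ.toTopRep) (φ σ : absoluteGaloisGroup F)
    (hσ : ∀ w : W, ρ (φ * σ * φ⁻¹) w = w) :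
    z.1 (φ * σ * φ⁻¹) = ρ φ (z.1 σ) := by
  have h1 : z.1 (φ * σ * φ⁻¹) = z.1 (φ * σ) + ρ.toTopRep.ρ (φ * σ) (z.1 φ⁻¹) := z.2 _ _
  have h2 : z.1 (φ * σ) = z.1 φ + ρ.toTopRep.ρ φ (z.1 σ) := z.2 _ _
  have h3 : z.1 φ + ρ.toTopRep.ρ φ (z.1 φ⁻¹) = 0 := by
    have h := z.2 φ φ⁻¹
    rw [mul_inv_cancel, contOneCocycles.apply_one] at h
    exact h.symm
  have h4 : ρ.toTopRep.ρ (φ * σ) (z.1 φ⁻¹) = ρ.toTopRep.ρ φ (z.1 φ⁻¹) := by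
    rw [show φ * σ = (φ * σ * φ⁻¹) * φ by group, ρ_mul_apply, ContinuousRep.toTopRep_ρ_apply (σ := φ * σ * φ⁻¹), hσ]
  rw [h1, h2, h4, add_assoc, add_left_comm, h3, add_zero, ContinuousRep.toTopRep_ρ_apply]

variable [Finite W]

/-- **THE SINGULAR SIDE WITH A NON-TRIVIAL FROBENIUS.**  `F` non-archimedean local with residue field of order `q`, `W` finite discrete of order
prime to the residue characteristic with INERTIA acting trivially, `φ` an arithmetic Frobenius.  There are a tame generator `σ₀ ∈ I_F` and an
additive `sing : H¹(F, W) → W` with `sing [z] = z(σ₀)` such that: **`sing c = 0 ⟺ c ∈ H¹_ur(F, W)`**; **`φ·(sing c) = q·(sing c)` for every `c`**;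
and **every `a ∈ W` with `φ·a = q·a` is `sing c` for some `c`**.  That is, `H¹(F, W)/H¹_ur(F, W) ≅ W^{φ = q}`.
[cite: SerreInventiones1972, §1.3 Prop. 2, §1.7 Prop. 5, §1.8 Prop. 6] [cite: Rubin2000, Lemma 1.3.2] [cite: MazurRubinMemoirs2004, Lemma 1.2.1]
[cite: Howard2004HeegnerKolyvagin, Prop. 1.1.7] -/
theorem exists_singular_parametrization_of_inertia_trivial
    (htrivI : ∀ τ ∈ absInertia F, ∀ w : W, ρ τ w = w) (hW : (Nat.card W).Coprime (ringChar 𝓀[F]))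
    {φ : absoluteGaloisGroup F} (hφ : IsAbsArithFrob φ) :
    ∃ (σ₀ : absInertia F) (sing : galoisCohomology ρ 1 →+ W),
      (∀ z : contOneCocycles ρ.toTopRep, sing (oneCocycleClass ρ.toTopRep z) = z.1 (σ₀ : absoluteGaloisGroup F)) ∧
      (∀ c, sing c = 0 ↔ c ∈ DiscreteGaloisModule.unramifiedSubgroup ρ 1) ∧
      (∀ c, ρ φ (sing c) = residueFieldCard F • sing c) ∧
      (∀ a : W, ρ φ a = residueFieldCard F • a → ∃ c, sing c = a) := by
  classical
  haveI : (absMaximalIdeal F).IsMaximal := absMaximalIdeal_isMaximal_holds F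
  letI : Field (absIntegers 𝒪[F] F ⧸ absMaximalIdeal F) := Ideal.Quotient.field _
  haveI : (absInertia F).Normal := absInertia_normal_holds F
  have hp : (ringChar 𝓀[F]).Prime := ringChar_residueField_prime (F := F)
  -- the level `d = #W` and a tame generator at that level
  have hd : 0 < Nat.card W := Nat.card_pos
  have hpd : ¬ ringChar 𝓀[F] ∣ Nat.card W := fun h ↦ hp.one_lt.ne' (Nat.Coprime.eq_one_of_dvd hW.symm h)
  obtain ⟨ϖ, hϖ⟩ := IsDiscreteValuationRing.exists_irreducible 𝒪[F]
  obtain ⟨σ₀, hσ₀⟩ := exists_isPrimitiveRoot_kummerCharacter (F := F)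
    (RingHom.id (absIntegers 𝒪[F] F ⧸ absMaximalIdeal F)) hd hpd hϖ
  have hkill : ∀ w : W, Nat.card W • w = 0 := fun w ↦ card_nsmul_eq_zero'
  -- restriction of a cocycle to inertia is a continuous homomorphism
  have hmulI : ∀ (z : contOneCocycles ρ.toTopRep) (σ τ : absInertia F),
      z.1 ((σ * τ : absInertia F) : absoluteGaloisGroup F) = z.1 σ + z.1 τ := fun z σ τ ↦ by
    have h := z.2 (σ : absoluteGaloisGroup F) (τ : absoluteGaloisGroup F)
    rw [ContinuousRep.toTopRep_ρ_apply, htrivI σ σ.2] at h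
    exact h
  have hcontI : ∀ z : contOneCocycles ρ.toTopRep, Continuous fun σ : absInertia F ↦ z.1 (σ : absoluteGaloisGroup F) :=
    fun z ↦ z.1.continuous.comp continuous_subtype_val
  -- `sing`: evaluation at `σ₀`, well defined on classes since coboundaries vanish on inertia
  let sing : galoisCohomology ρ 1 →+ W :=
    liftH1Add ρ.toTopRep (evalCocycle ρ (σ₀ : absoluteGaloisGroup F)) fun z hz ↦ by
      obtain ⟨v, hv⟩ := (oneCocycleClass_eq_zero_iff ρ.toTopRep z).mp hz
      rw [evalCocycle_apply, hv, ContinuousRep.toTopRep_ρ_apply, htrivI _ σ₀.2, sub_self]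
  have hsing : ∀ z : contOneCocycles ρ.toTopRep, sing (oneCocycleClass ρ.toTopRep z) = z.1 (σ₀ : absoluteGaloisGroup F) :=
    fun z ↦ liftH1Add_oneCocycleClass ρ.toTopRep _ _ z
  refine ⟨σ₀, sing, hsing, fun c ↦ ?_, fun c ↦ ?_, fun a ha ↦ ?_⟩
  · -- kernel = unramified classes
    obtain ⟨z, rfl⟩ := oneCocycleClass_surjective ρ.toTopRep c
    rw [hsing]
    constructor
    · intro h0
      exact (oneCocycleClass_mem_unramifiedSubgroup_iff_forall_eq_zero ρ htrivI z).mpr fun τ hτ ↦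
        apply_eq_zero_of_apply_eq_zero_of_isPrimitiveRoot F (RingHom.id _) hd hpd hϖ hσ₀
          (fun σ : absInertia F ↦ z.1 σ) (hcontI z) (hmulI z) (fun σ ↦ hkill _) h0 ⟨τ, hτ⟩
    · intro h
      exact (oneCocycleClass_mem_unramifiedSubgroup_iff_forall_eq_zero ρ htrivI z).mp h σ₀ σ₀.2
  · -- the twist relation `φ·z(σ₀) = q·z(σ₀)` for every class
    obtain ⟨z, rfl⟩ := oneCocycleClass_surjective ρ.toTopRep c
    rw [hsing]
    have hconj : φ * (σ₀ : absoluteGaloisGroup F) * φ⁻¹ ∈ absInertia F :=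
      (inferInstance : (absInertia F).Normal).conj_mem _ σ₀.2 φ
    have h1 := apply_frob_conj_eq_card_nsmul F hW (fun σ : absInertia F ↦ z.1 σ) (hmulI z) (hcontI z) hφ σ₀
    have h2 := apply_frob_conj_eq_rho_apply ρ z φ σ₀ (htrivI _ hconj)
    change z.1 (φ * σ₀ * φ⁻¹) = residueFieldCard F • z.1 σ₀ at h1
    rw [← h1, h2]
  · -- every `a` with `φ·a = q·a` is a value: the tame homomorphism `σ₀ ↦ a` is Frobenius-invariant
    obtain ⟨f, hf, hmul, hfa⟩ := exists_continuous_apply_eq_of_isPrimitiveRoot F (RingHom.id _) hd hϖ hσ₀ a (hkill a)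
    have hφ1 : IsFrobPow φ 1 := IsAbsArithFrob.isFrobPow_holds hφ
    -- `φ·f(σ) = q·f(σ)` for all `σ` (a tame homomorphism vanishing at `σ₀` vanishes)
    have hrel : ∀ σ : absInertia F, ρ φ (f σ) = residueFieldCard F • f σ := by
      intro σ
      have h0 := apply_eq_zero_of_apply_eq_zero_of_isPrimitiveRoot F (RingHom.id _) hd hpd hϖ hσ₀
        (fun σ : absInertia F ↦ ρ φ (f σ) - residueFieldCard F • f σ)
        ((continuous_of_discreteTopology : Continuous fun w : W ↦ ρ φ w - residueFieldCard F • w).comp hf)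
        (fun σ τ ↦ by simp only [hmul, map_add, smul_add]; abel) (fun σ ↦ by rw [smul_sub, hkill, hkill, sub_zero])
        (by simp only [hfa, ha, sub_self]) σ
      exact sub_eq_zero.mp h0
    let y : contOneCocycles (subgroupRep ρ.toTopRep (absInertia F)) :=
      ⟨⟨f, hf⟩, fun g h ↦ by
        change f (g * h) = f g + ρ (g : absoluteGaloisGroup F) (f h)
        rw [hmul, htrivI g g.2]⟩
    have hinv : conjMap ρ.toTopRep (absInertia F) φ 1 (oneCocycleClass _ y) = oneCocycleClass _ y := by
      rw [conjMap_oneCocycleClass]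
      congr 1
      apply Subtype.ext
      ext σ
      rw [conj_pullback_apply]
      change ρ φ (f (subgroupConj (absInertia F) φ σ)) = f σ
      set σ' := subgroupConj (absInertia F) φ σ with hσ'
      have hback : (⟨φ * σ' * φ⁻¹, (inferInstance : (absInertia F).Normal).conj_mem _ σ'.2 φ⟩ : absInertia F) = σ :=
        Subtype.ext (by
          change φ * (φ⁻¹ * (σ : absoluteGaloisGroup F) * φ) * φ⁻¹ = σ
          group)
      have htame := apply_frob_conj_eq_card_nsmul F hW f hmul hf hφ σ'
      rw [hback] at htame
      rw [htame, hrel]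
    obtain ⟨xc, hxc⟩ := exists_resSubgroup_absInertia_eq_of_conjMap_eq F ρ hφ1 (oneCocycleClass _ y) hinv
    obtain ⟨z, rfl⟩ := oneCocycleClass_surjective ρ.toTopRep xc
    refine ⟨oneCocycleClass ρ.toTopRep z, ?_⟩
    rw [hsing, ← hfa]
    rw [resSubgroup_oneCocycleClass] at hxc
    have hyz := oneCocycleClass_injective_of_trivial (X := subgroupRep ρ.toTopRep (absInertia F))
      (fun g x ↦ by change ρ (g : absoluteGaloisGroup F) x = x; exact htrivI g g.2 x) hxc
    exact congrArg (fun w : contOneCocycles (subgroupRep ρ.toTopRep (absInertia F)) ↦ w.1 σ₀) hyz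

end Generic

end Summit.BirchSwinnertonDyer.BirchSwinnertonDyer.Theorems.GenusExact.PlusDescent

end
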